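import Summits.Ventures.Crystal3D.Theorems.StickyWulffConstantGenericWallFloorGrainCredits
import HarnessLib

/-!
# Outer credits of the TOP clamped slab (mirror statements of `…GrainCredits`)

HONEST FRAMING. Part of the venture `Summits/Ventures/Crystal3D` (cell `crystal3d-full`), helper for the
crux `GenericWallFloor` (stmt-Ventures-19480) of `route-Ventures-StickyWulffConstant`, REGISTERED line
`WallLedgerG` (planner cf-p1 gen 16), stub `stub_twoSlabAdhesion : TwoSlabAdhesion` (THE CRUX of the line).
Bookkeeping for the two-grain general-filling ledger: the statements of `…GrainCredits` for the clamped
sample of the TOP grain, `P = Λ ∩ {h + R₀ ≤ x₂ ≤ h + 2R₀, x₀² + x₁² ≤ ρ²}`, proved directly in the same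
way (the window lemmas `tops_ge_lineCount`, `mem_sample_of_mem_core` are window-agnostic).  Rung credit
only; F-C1 not moved.

* `sum_abs_inner_eq_two_mul_sum_up` — `Σ_w |⟪A w, e₃⟫| = 2 Σ_{⟪A w,e₃⟫ > 0} |⟪A w, e₃⟫|`;
* `outerCredits_ge_top` — the UP-slot vacancies of the top sample count its outer face:
  `Σ_{⟪A w, e₃⟫ > 0} #{p ∈ P : p + A w ∉ P} ≥ 2 φ π ρ² − 120 √2 π ρ`;
* `outerSlot_not_mem_top` — such a vacancy is a genuinely empty slot of `X` (the site lies above the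
  cell or beside it);
* `foreign_low_or_rim_top` — with the clean top sliver, a ball off the grain is below `h + R₀ + 1` or in
  the rim zone;
* `not_outerCredit_of_foreign_top` — hence a non-rim top-sample ball touching a foreign ball has no
  UP-slot vacancy.

WHAT THIS IS NOT: no new mathematics; F-C1 not moved.
-/

noncomputable section

namespace Summit.Ventures.Crystal3D.Theorems

open Summit.Ventures.Crystal3D Finset
open Literature.MathematicalPhysics.StatisticalMechanics (fccStacking barlowStacking constHagg)
open scoped InnerProductSpace

/-- `Σ_w |⟪A w, e₃⟫| = 2 · Σ_{up slots} |⟪A w, e₃⟫|` (the slots come in pairs `±w`). -/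
theorem sum_abs_inner_eq_two_mul_sum_up
    (A : EuclideanSpace ℝ (Fin 3) ≃ₗᵢ[ℝ] EuclideanSpace ℝ (Fin 3)) :
    ∑ w ∈ fccSlots, |⟪A w, EuclideanSpace.single (2 : Fin 3) (1 : ℝ)⟫_ℝ| =
      2 * ∑ w ∈ fccSlots.filter (fun w => 0 < ⟪A w, EuclideanSpace.single (2 : Fin 3) (1 : ℝ)⟫_ℝ),
        |⟪A w, EuclideanSpace.single (2 : Fin 3) (1 : ℝ)⟫_ℝ| := by
  classical
  set e₃ := EuclideanSpace.single (2 : Fin 3) (1 : ℝ) with he₃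
  have hdown := sum_abs_inner_eq_two_mul_sum_down A
  -- the up-sum equals the down-sum under `w ↦ −w`
  have hud : ∑ w ∈ fccSlots.filter (fun w => 0 < ⟪A w, e₃⟫_ℝ), |⟪A w, e₃⟫_ℝ| =
      ∑ w ∈ fccSlots.filter (fun w => ⟪A w, e₃⟫_ℝ < 0), |⟪A w, e₃⟫_ℝ| := by
    refine Finset.sum_nbij' (fun w => -w) (fun w => -w) ?_ ?_ ?_ ?_ ?_
    · intro w hw
      rw [mem_filter] at hw ⊢
      refine ⟨neg_mem_fccSlots hw.1, ?_⟩
      rw [map_neg, inner_neg_left]; linarith [hw.2]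
    · intro w hw
      rw [mem_filter] at hw ⊢
      refine ⟨neg_mem_fccSlots hw.1, ?_⟩
      rw [map_neg, inner_neg_left]; linarith [hw.2]
    · intro w _; exact neg_neg w
    · intro w _; exact neg_neg w
    · intro w _; rw [map_neg, inner_neg_left, abs_neg]
  rw [hdown, ← hud]

/-- **Outer credits of the top sample count its outer face.** -/
theorem outerCredits_ge_top
    (A : EuclideanSpace ℝ (Fin 3) ≃ₗᵢ[ℝ] EuclideanSpace ℝ (Fin 3)) (t : EuclideanSpace ℝ (Fin 3))
    (P : Finset (EuclideanSpace ℝ (Fin 3))) (R₀ h ρ : ℝ) (hR₀ : 3 ≤ R₀) (hρ : R₀ ≤ ρ)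
    (hP : ∀ p, p ∈ P ↔ (p ∈ (fun q => A q + t) '' fccStacking 1 (Real.sqrt (2 / 3)) ∧
      h + R₀ ≤ p 2 ∧ p 2 ≤ h + 2 * R₀ ∧ p 0 ^ 2 + p 1 ^ 2 ≤ ρ ^ 2)) :
    2 * (Real.sqrt 2 / 4 * ∑ w ∈ fccSlots, |⟪A w, EuclideanSpace.single (2 : Fin 3) (1 : ℝ)⟫_ℝ|) *
        Real.pi * ρ ^ 2 - 120 * Real.sqrt 2 * Real.pi * ρ ≤
      ∑ w ∈ fccSlots.filter (fun w => 0 < ⟪A w, EuclideanSpace.single (2 : Fin 3) (1 : ℝ)⟫_ℝ),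
        (((P.filter fun p => p + A w ∉ P).card : ℕ) : ℝ) := by
  classical
  set e₃ := EuclideanSpace.single (2 : Fin 3) (1 : ℝ) with he₃
  set Up := fccSlots.filter (fun w => 0 < ⟪A w, e₃⟫_ℝ) with hUp
  have hP' : ∀ p, p ∈ P ↔ (p ∈ (fun q => A q + t) '' fccStacking 1 (Real.sqrt (2 / 3)) ∧
      (h + R₀) ≤ p 2 ∧ p 2 ≤ (h + R₀) + R₀ ∧ p 0 ^ 2 + p 1 ^ 2 ≤ ρ ^ 2) := by
    intro p; rw [hP p, show h + R₀ + R₀ = h + 2 * R₀ by ring]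
  have hcls : ∀ w ∈ Up, Real.sqrt 2 * |⟪A w, e₃⟫_ℝ| * Real.pi * ρ ^ 2 - 10 * Real.sqrt 2 * Real.pi * ρ ≤
      (((P.filter fun p => p + A w ∉ P).card : ℕ) : ℝ) := by
    intro w hw
    have hws : w ∈ fccSlots := (mem_filter.1 hw).1
    obtain ⟨Ea, Eb, hEa, hEb, hdet, hframe, -⟩ := exists_frame_of_mem_fccSlots hws
    exact tops_ge_lineCount A t (h + R₀) R₀ ρ (by linarith) hρ P hP' Ea Eb w hEa hEb
      (norm_eq_one_of_mem_fccSlots hws) hdet hframe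
  have hsum := Finset.sum_le_sum hcls
  rw [Finset.sum_sub_distrib, Finset.sum_const, nsmul_eq_mul] at hsum
  have hcardUp : (Up.card : ℝ) ≤ 12 := by
    have : Up.card ≤ fccSlots.card := card_filter_le _ _
    rw [card_fccSlots] at this
    exact_mod_cast this
  have hpair := sum_abs_inner_eq_two_mul_sum_up A
  have hS : ∑ w ∈ Up, Real.sqrt 2 * |⟪A w, e₃⟫_ℝ| * Real.pi * ρ ^ 2 =
      Real.sqrt 2 * Real.pi * ρ ^ 2 * ∑ w ∈ Up, |⟪A w, e₃⟫_ℝ| := by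
    rw [Finset.mul_sum]; refine Finset.sum_congr rfl fun w _ => ?_; ring
  rw [hS] at hsum
  have hnn : (0 : ℝ) ≤ 10 * Real.sqrt 2 * Real.pi * ρ := by
    have : (0 : ℝ) ≤ ρ := by linarith
    positivity
  have e : 2 * (Real.sqrt 2 / 4 * ∑ w ∈ fccSlots, |⟪A w, e₃⟫_ℝ|) * Real.pi * ρ ^ 2 =
      Real.sqrt 2 * Real.pi * ρ ^ 2 * ∑ w ∈ Up, |⟪A w, e₃⟫_ℝ| := by
    rw [hpair]; ring
  rw [e]
  nlinarith

/-- **Top outer credits are genuine.**  If all of `X` lies in the cell, `p ∈ P` (the top sample) and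
`w` is a slot with `⟪A w, e₃⟫ ≥ 0`, then `p + A w ∉ P` forces `p + A w ∉ X`. -/
theorem outerSlot_not_mem_top
    (A : EuclideanSpace ℝ (Fin 3) ≃ₗᵢ[ℝ] EuclideanSpace ℝ (Fin 3)) (t : EuclideanSpace ℝ (Fin 3))
    (X P : Finset (EuclideanSpace ℝ (Fin 3))) (R₀ h ρ : ℝ)
    (hcell : ∀ p ∈ X, -(2 * R₀) ≤ p 2 ∧ p 2 ≤ h + 2 * R₀ ∧ p 0 ^ 2 + p 1 ^ 2 ≤ ρ ^ 2)
    (hP : ∀ p, p ∈ P ↔ (p ∈ (fun q => A q + t) '' fccStacking 1 (Real.sqrt (2 / 3)) ∧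
      h + R₀ ≤ p 2 ∧ p 2 ≤ h + 2 * R₀ ∧ p 0 ^ 2 + p 1 ^ 2 ≤ ρ ^ 2))
    {w : EuclideanSpace ℝ (Fin 3)} (hwΛ : w ∈ fccStacking 1 (Real.sqrt (2 / 3)))
    (hα : 0 ≤ ⟪A w, EuclideanSpace.single (2 : Fin 3) (1 : ℝ)⟫_ℝ)
    {p : EuclideanSpace ℝ (Fin 3)} (hp : p ∈ P) (hnot : p + A w ∉ P) : p + A w ∉ X := by
  intro hX
  apply hnot
  rw [hP]
  obtain ⟨hpΛ, hp1, hp2, hp3⟩ := (hP p).1 hp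
  obtain ⟨-, hX2, hX3⟩ := hcell _ hX
  refine ⟨movedFcc_add_site_mem A t hpΛ hwΛ, ?_, hX2, hX3⟩
  have : (p + A w) 2 = p 2 + ⟪A w, EuclideanSpace.single (2 : Fin 3) (1 : ℝ)⟫_ℝ := by
    rw [PiLp.add_apply, apply_two_eq_inner_e₃ (A w)]
  rw [this]; linarith

/-- **A foreign ball is low or in the rim zone (top sample).**  With the top sample complete in
`[h + R₀, h + 2R₀] × disc ρ` (`ρ ≥ 1`), `X ⊇ P` `1`-separated and the clean TOP sliver, a ball `q ∈ X`
off the grain has `q₂ < h + R₀ + 1` or `(ρ − 1)² < q₀² + q₁²`. -/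
theorem foreign_low_or_rim_top
    (A : EuclideanSpace ℝ (Fin 3) ≃ₗᵢ[ℝ] EuclideanSpace ℝ (Fin 3)) (t : EuclideanSpace ℝ (Fin 3))
    (X P : Finset (EuclideanSpace ℝ (Fin 3))) (R₀ h ρ : ℝ) (hρ : 1 ≤ ρ)
    (hX : ∀ p ∈ X, ∀ q ∈ X, p ≠ q → 1 ≤ dist p q) (hPX : P ⊆ X)
    (hP : ∀ p, p ∈ P ↔ (p ∈ (fun q => A q + t) '' fccStacking 1 (Real.sqrt (2 / 3)) ∧
      h + R₀ ≤ p 2 ∧ p 2 ≤ h + 2 * R₀ ∧ p 0 ^ 2 + p 1 ^ 2 ≤ ρ ^ 2))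
    (hclean : ∀ p ∈ X, h + 2 * R₀ - 1 < p 2 → p ∈ (fun q => A q + t) '' fccStacking 1 (Real.sqrt (2 / 3)))
    {q : EuclideanSpace ℝ (Fin 3)} (hqX : q ∈ X)
    (hqΛ : q ∉ (fun q => A q + t) '' fccStacking 1 (Real.sqrt (2 / 3))) :
    q 2 < h + R₀ + 1 ∨ (ρ - 1) ^ 2 < q 0 ^ 2 + q 1 ^ 2 := by
  by_contra hcon
  push Not at hcon
  obtain ⟨hq2, hqr⟩ := hcon
  have hhigh : q 2 ≤ h + 2 * R₀ - 1 := by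
    by_contra hlt
    push Not at hlt
    exact hqΛ (hclean q hqX hlt)
  have hPimp : ∀ p : EuclideanSpace ℝ (Fin 3),
      p ∈ (fun y => A y + t) '' barlowStacking 1 (Real.sqrt (2 / 3)) constHagg →
      h + R₀ ≤ p 2 → p 2 ≤ h + 2 * R₀ → p 0 ^ 2 + p 1 ^ 2 ≤ ρ ^ 2 → p ∈ P :=
    fun p hp h1 h2 h3 => (hP p).2 ⟨hp, h1, h2, h3⟩
  have hmem := mem_sample_of_mem_core constHagg A t X P (h + R₀) (h + 2 * R₀) ρ hρ hPX hX hPimp q hqX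
    hq2 (by linarith) hqr
  exact hqΛ ((hP q).1 hmem).1

/-- **A non-rim top-sample ball touching a foreign ball carries no outer credit** (`R₀ ≥ 3`): for every
slot `w` with `⟪A w, e₃⟫ ≥ 0`, `p + A w ∈ P`. -/
theorem not_outerCredit_of_foreign_top
    (A : EuclideanSpace ℝ (Fin 3) ≃ₗᵢ[ℝ] EuclideanSpace ℝ (Fin 3)) (t : EuclideanSpace ℝ (Fin 3))
    (X P : Finset (EuclideanSpace ℝ (Fin 3))) (R₀ h ρ : ℝ) (hR₀ : 3 ≤ R₀) (hρ : R₀ ≤ ρ)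
    (hX : ∀ p ∈ X, ∀ q ∈ X, p ≠ q → 1 ≤ dist p q) (hPX : P ⊆ X)
    (hP : ∀ p, p ∈ P ↔ (p ∈ (fun q => A q + t) '' fccStacking 1 (Real.sqrt (2 / 3)) ∧
      h + R₀ ≤ p 2 ∧ p 2 ≤ h + 2 * R₀ ∧ p 0 ^ 2 + p 1 ^ 2 ≤ ρ ^ 2))
    (hclean : ∀ p ∈ X, h + 2 * R₀ - 1 < p 2 → p ∈ (fun q => A q + t) '' fccStacking 1 (Real.sqrt (2 / 3)))
    {p q : EuclideanSpace ℝ (Fin 3)} (hp : p ∈ P) (hprim : p 0 ^ 2 + p 1 ^ 2 ≤ (ρ - 2) ^ 2)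
    (hqX : q ∈ X) (hqΛ : q ∉ (fun q => A q + t) '' fccStacking 1 (Real.sqrt (2 / 3)))
    (hpq : dist p q = 1)
    {w : EuclideanSpace ℝ (Fin 3)} (hw : w ∈ fccSlots)
    (hα : 0 ≤ ⟪A w, EuclideanSpace.single (2 : Fin 3) (1 : ℝ)⟫_ℝ) : p + A w ∈ P := by
  have hρ1 : (1 : ℝ) ≤ ρ := by linarith
  have hρ2 : (0 : ℝ) ≤ ρ - 2 := by linarith
  obtain ⟨hpΛ, hp1, hp2, hp3⟩ := (hP p).1 hp
  have hsp : Real.sqrt (p 0 ^ 2 + p 1 ^ 2) ≤ ρ - 2 := by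
    rw [← Real.sqrt_sq hρ2]; exact Real.sqrt_le_sqrt hprim
  have hlatw : (p + A w) 0 ^ 2 + (p + A w) 1 ^ 2 ≤ ρ ^ 2 := by
    have h1 := sqrt_lateral_add_le p (A w)
    rw [LinearIsometryEquiv.norm_map, norm_eq_one_of_mem_fccSlots hw] at h1
    have h2 : Real.sqrt ((p + A w) 0 ^ 2 + (p + A w) 1 ^ 2) ≤ ρ := by linarith
    have h3 := Real.sq_sqrt (by positivity : (0 : ℝ) ≤ (p + A w) 0 ^ 2 + (p + A w) 1 ^ 2)
    have h4 : (0 : ℝ) ≤ Real.sqrt ((p + A w) 0 ^ 2 + (p + A w) 1 ^ 2) := Real.sqrt_nonneg _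
    nlinarith
  rcases foreign_low_or_rim_top A t X P R₀ h ρ hρ1 hX hPX hP hclean hqX hqΛ with hq2 | hqr
  · -- `p₂ < h + R₀ + 2`, so `p + A w` is still inside the window
    have hpz : p 2 < h + R₀ + 2 := by
      have := abs_apply_sub_le_dist p q 2
      rw [hpq] at this
      have := (abs_le.1 this).2
      linarith
    have hα1 : ⟪A w, EuclideanSpace.single (2 : Fin 3) (1 : ℝ)⟫_ℝ ≤ 1 :=
      (abs_le.1 (abs_inner_slot_le_one A hw)).2
    have e2 : (p + A w) 2 = p 2 + ⟪A w, EuclideanSpace.single (2 : Fin 3) (1 : ℝ)⟫_ℝ := by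
      rw [PiLp.add_apply, apply_two_eq_inner_e₃ (A w)]
    rw [hP]
    refine ⟨movedFcc_add_site_mem A t hpΛ (mem_fcc_of_mem_fccSlots hw), ?_, ?_, hlatw⟩
    · rw [e2]; linarith
    · rw [e2]; linarith
  · exfalso
    have h1 := lateral_radius_le_add_dist q p
    rw [dist_comm, hpq] at h1
    have hq : ρ - 1 < Real.sqrt (q 0 ^ 2 + q 1 ^ 2) := by
      rw [← Real.sqrt_sq (by linarith : (0 : ℝ) ≤ ρ - 1)]
      exact Real.sqrt_lt_sqrt (sq_nonneg _) hqr
    linarith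

end Summit.Ventures.Crystal3D.Theorems

end
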